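import Summits.ABC.IUTFork.LDHSlotResidue
import Literature.IUT.LogVolume.GenuineLogThetaIdeles
import HarnessLib

/-!
# The fork at [IUTchIII] Corollary 3.12, L-DH level: what the (U)-computable half asserts AT THE `λ`-LINE, place
# by place — the pair inequality on the `q`-orders of `j(λ)` at two places of `F_mod` over one prime

Record-only PROOF file (D-0012) of the abc-iut cell (campaign-S seat abc-iut-S7, gen 4; sequel to abc-iut-S8's
`LDHSlotResidue.lean` and to `LDHSlotResidueSplitWitness.lean`); TAKES NO SIDE on [IUTchIII] Cor. 3.12 or
[IUTchIV] Thm. 1.10. S. Mochizuki, *IUT IV* [Mochizuki2012], Thm. 1.10 proof Step (v), kurims pp. 27–28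
(symmetrisation in `i† ∈ I`), Cor. 2.2 (ii) proof p. 46 ((P5): `𝕍^bad_mod` = the places of `F_mod` not dividing
`2l` of bad multiplicative reduction); Dupuy–Hilado [DupuyHilado2025] §3.3 (`P_q = Σ_{v∈S} ord_v(q_v)/(2l)·[v]`,
`ord_v(q_v) = −ord_v(j_E)`), §3.6 (weights `Pr(v) = n_v/[F_mod:ℚ]`), §4.7, §4.10–4.12.

abc-iut-S8 proved `PointDict.slotResidue_le_of_hullVolumeAtDatum`: the (U)-computable half
`Cor22.HullVolumeAtDatum P l δ` (the conclusion of the crux's registered stubs `stub_hullVolume` / `stub_hullRegime`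
of stmt-ABC-19678, with `δ = B_III(P,l)`) forces `slotResidue(T) ≤ δ` at every genuine Θ-volume datum `T`, and
`slotResidue_ge_pair_closed` bounds the residue below by any pair of places over one support prime. THIS FILE
writes that consequence in the PRINTED QUANTITIES of the point's initial Θ-data — the `q`-orders `−ord_v(j_E)` at
the places `v` of the field of moduli `F_mod = ℚ(j_E)`, their residue degrees and local degrees:

* `PointDict.mu_eq` — the canonical slot value of a datum at a place `u` of `F_mod`:
  `μ_T(u) = P_q(u)·ln N(u)/n_u = (−ord_u(j_E))/(2l)·ln N(u)/n_u` for `u ∈ 𝕍^bad_mod` and `0` otherwise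
  (abc-iut-S2's `IsVolumeInputOf.X_eq`: the datum's pilot data ARE `(j_E, 𝕍^bad_mod, l)` over `F_mod`);
* `PointDict.avgSq_eq` — the procession average `(ℓ⋆+1)(2ℓ⋆+1)/6 = l(l+1)/12` at a datum of `(P, l)`;
* **`PointDict.pair_le_of_hullEstimateOf`** — `T.HullEstimateOf δ` forces, for every support prime `p` and places
  `v, w` of `F_mod` over `p`, `Pr(v)·Pr(w)·(l(l+1)/12)·(μ_T(v) − μ_T(w)) ≤ δ`;
* **`PointDict.ordPair_le_of_hullEstimateOf`** — at a bad place `v ∈ 𝕍^bad_mod` and a place `w ∉ 𝕍^bad_mod` over the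
  same prime: `Pr(v)·Pr(w)·((l+1)/24)·(−ord_v(j_E))·ln N(v)/n_v ≤ δ` — the local height of `j(λ)` at `v`, weighted
  by the two local-degree probabilities, is bounded by the hull constant;
* **`PointDict.ordPair_le_of_hullVolumeAtDatum`** — the same from `Cor22.HullVolumeAtDatum P l δ` for EVERY datum at
  `(P, l)`: the place-by-place Diophantine content of the (U)-line's child (ii′) beyond print's Steps (ii)–(iii).

READING (nothing asserted about print). At `d_mod = 1` there is one place of `F_mod` over each prime, no pair
exists and the statements are empty (the «d = 1 cut»); at `d_mod ≥ 2` with a support prime under a bad and a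
non-bad place of `F_mod`, the registered (U)-stub with print's `δ = B_III(P,l)` — a constant in `d_mod`,
`log-diff`, `log-cond`, `l` only — asserts an inequality «weighted local height at ONE place `≤ B_III`», which no
volume computation supplies (`LDHSlotResidueSplitWitness`: synthetic inputs violate every depth-free constant) and
whose failure at an actual admissible point would be an abc triple of quality above `24·(1 + 12·d_mod/l)` over a
field with `d_mod ≥ 2` (from the terms `(l+1)/4·(1+12d_mod/l)·(log-diff + log-cond)` and
`(l+1)/4·(20/3)·log(d*_mod·l)·π(d*_mod·l)` of `B_III`). HONEST SCOPE: consequences of the typed (U)-computable half at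
genuine data; no datum is constructed, no side taken on Cor. 3.12 / Thm. 1.10; typed ≠ proved. PROOF-ONLY file.
[cite: Mochizuki2012, IUTchIV Thm. 1.10 Step (v) p. 27–28] [cite: Mochizuki2012, IUTchIV Cor. 2.2 (ii) proof p. 46]
[cite: DupuyHilado2025, §3.3, §3.6, §4.7, §4.10–4.12] [claim: Mochizuki2012, status: disputed] for every IUT quotation.
-/

noncomputable section

namespace Summit.ABC.IUTFork

open Literature.IUT.HodgeTheaters Literature.IUT.LogVolume NumberField IsDedekindDomain
open Literature.NumberTheory.DiophantineGeometry.GenEll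
open scoped Classical

namespace PointDict

variable {P : NFPoint} {l : ℕ}

/-- **The datum's pilot data are the printed ones**: its bad set is `𝕍^bad_mod` (as primes of `𝓞_{F_mod}`), its
`j`-invariant is `j_E ∈ F_mod`, its `l` is `l` (abc-iut-S2's `IsVolumeInputOf.X_eq` + `pilotData_S/_jE/_l`).
[cite: Mochizuki2012, IUTchI Def. 3.1 (b)(c) p. 61] -/
theorem X_S_eq (T : Cor22.ThetaVolumeDatumAt P l) :
    (letI := T.instFieldF; letI := T.instNumberFieldF; letI := T.instAlgebraF; letI := T.instFieldK
     letI := T.instNumberFieldK; letI := T.instAlgebraK; letI := T.instFieldFbar; letI := T.instAlgebraFbar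
     letI := T.instAlgebraKFbar; letI := T.instIsElliptic
     T.I.X.S = ThetaData.badPrimesMod T.D ∧ T.I.X.jE = ThetaData.jMod T.E ∧ T.I.X.l = l) := by
  letI := T.instFieldF; letI := T.instNumberFieldF; letI := T.instAlgebraF; letI := T.instFieldK
  letI := T.instNumberFieldK; letI := T.instAlgebraK; letI := T.instFieldFbar; letI := T.instAlgebraFbar
  letI := T.instAlgebraKFbar; letI := T.instIsElliptic
  rw [T.isVolumeInputOf.X_eq]
  exact ⟨rfl, rfl, rfl⟩

/-- **The canonical slot value of a datum at a place `u` of `F_mod`**: `μ_T(u) := P_q(u)·ln N(u)/n_u` equals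
`(−ord_u(j_E))/(2l)·ln N(u)/n_u` if `u ∈ 𝕍^bad_mod` and `0` otherwise (`P_q(u) = ord_u(q_u)/(2l)`,
`ord_u(q_u) = −ord_u(j_E)`, Dupuy–Hilado §3.3; `P_q` vanishes off `𝕍^bad_mod`). [cite: DupuyHilado2025, §3.3, §3.6] -/
theorem mu_eq (T : Cor22.ThetaVolumeDatumAt P l) :
    (letI := T.instFieldF; letI := T.instNumberFieldF; letI := T.instAlgebraF; letI := T.instFieldK
     letI := T.instNumberFieldK; letI := T.instAlgebraK; letI := T.instFieldFbar; letI := T.instAlgebraFbar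
     letI := T.instAlgebraKFbar; letI := T.instIsElliptic
     ∀ u : HeightOneSpectrum (𝓞 (fieldOfModuli T.E)),
       T.I.X.qPilot u * logNorm (fieldOfModuli T.E) u / (localDegree (fieldOfModuli T.E) u : ℝ) =
         if u ∈ ThetaData.badPrimesMod T.D then
           ((-ord (fieldOfModuli T.E) u (ThetaData.jMod T.E) : ℤ) : ℝ) / (2 * (l : ℝ)) *
             logNorm (fieldOfModuli T.E) u / (localDegree (fieldOfModuli T.E) u : ℝ)
         else 0) := by
  letI := T.instFieldF; letI := T.instNumberFieldF; letI := T.instAlgebraF; letI := T.instFieldK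
  letI := T.instNumberFieldK; letI := T.instAlgebraK; letI := T.instFieldFbar; letI := T.instAlgebraFbar
  letI := T.instAlgebraKFbar; letI := T.instIsElliptic
  intro u
  obtain ⟨hS, hj, hl⟩ := X_S_eq T
  by_cases hu : u ∈ ThetaData.badPrimesMod T.D
  · rw [if_pos hu]
    have hu' : u ∈ T.I.X.S := by rw [hS]; exact hu
    rw [T.I.X.qPilot_apply_of_mem hu']
    have hq : (T.I.X.ordq u : ℝ) = ((-ord (fieldOfModuli T.E) u (ThetaData.jMod T.E) : ℤ) : ℝ) := by
      rw [PilotData.ordq, hj]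
    rw [hq, hl]
  · rw [if_neg hu]
    have hu' : u ∉ T.I.X.S := by rw [hS]; exact hu
    rw [T.I.X.qPilot_apply_of_not_mem hu', zero_mul, zero_div]

/-- **The procession average at a datum of `(P, l)`**: `(ℓ⋆+1)(2ℓ⋆+1)/6 = l(l+1)/12` (`l = 2ℓ⋆+1`, c312-3's
`PilotData.l_cast`). [cite: DupuyHilado2025, §3.3] -/
theorem avgSq_eq (T : Cor22.ThetaVolumeDatumAt P l) :
    (letI := T.instFieldF; letI := T.instNumberFieldF; letI := T.instAlgebraF; letI := T.instFieldK
     letI := T.instNumberFieldK; letI := T.instAlgebraK; letI := T.instFieldFbar; letI := T.instAlgebraFbar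
     letI := T.instAlgebraKFbar; letI := T.instIsElliptic
     ((T.I.X.lstar : ℝ) + 1) * (2 * T.I.X.lstar + 1) / 6) = (l : ℝ) * ((l : ℝ) + 1) / 12 := by
  letI := T.instFieldF; letI := T.instNumberFieldF; letI := T.instAlgebraF; letI := T.instFieldK
  letI := T.instNumberFieldK; letI := T.instAlgebraK; letI := T.instFieldFbar; letI := T.instAlgebraFbar
  letI := T.instAlgebraKFbar; letI := T.instIsElliptic
  have h1 : (T.I.X.l : ℝ) = 2 * T.I.X.lstar + 1 := T.I.X.l_cast
  have h2 : T.I.X.l = l := (X_S_eq T).2.2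
  rw [h2] at h1
  rw [h1]
  ring

/-- **The (U)-computable half at a datum forces the pair inequality at every support prime**: `T.HullEstimateOf δ`
gives, for `p ∈ T(I)` and places `v, w` of `F_mod` over `p`, `Pr(v)·Pr(w)·(l(l+1)/12)·(μ_T(v) − μ_T(w)) ≤ δ`
(abc-iut-S8's `DHData.pair_le_of_hullEstimateOf` read at the datum; `μ_T` as in `mu_eq`).
[cite: Mochizuki2012, IUTchIV Thm. 1.10 Step (v) p. 27–28] [cite: DupuyHilado2025, §4.7, §4.12] -/
theorem pair_le_of_hullEstimateOf (T : Cor22.ThetaVolumeDatumAt P l) {δ : ℝ} (h : T.HullEstimateOf δ) :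
    (letI := T.instFieldF; letI := T.instNumberFieldF; letI := T.instAlgebraF; letI := T.instFieldK
     letI := T.instNumberFieldK; letI := T.instAlgebraK; letI := T.instFieldFbar; letI := T.instAlgebraFbar
     letI := T.instAlgebraKFbar; letI := T.instIsElliptic
     ∀ (p : ℕ) [Fact p.Prime], p ∈ T.I.supportPrimes → ∀ v w : placesOver (fieldOfModuli T.E) p,
       weight (fieldOfModuli T.E) v.1 * weight (fieldOfModuli T.E) w.1 * ((l : ℝ) * ((l : ℝ) + 1) / 12) *
         (T.I.X.qPilot v.1 * logNorm (fieldOfModuli T.E) v.1 / (localDegree (fieldOfModuli T.E) v.1 : ℝ)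
           - T.I.X.qPilot w.1 * logNorm (fieldOfModuli T.E) w.1 / (localDegree (fieldOfModuli T.E) w.1 : ℝ))
         ≤ δ) := by
  letI := T.instFieldF; letI := T.instNumberFieldF; letI := T.instAlgebraF; letI := T.instFieldK
  letI := T.instNumberFieldK; letI := T.instAlgebraK; letI := T.instFieldFbar; letI := T.instAlgebraFbar
  letI := T.instAlgebraKFbar; letI := T.instIsElliptic
  intro p _ hp v w
  have h1 := DHData.pair_le_of_hullEstimateOf T.I h hp v w
  rw [avgSq_eq T] at h1
  exact h1

/-- The residue characteristic of a bad place of `F_mod` is a support prime of the datum's input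
(`T(I) ⊇ {p_v : v ∈ 𝕍^bad_mod}`). [cite: DupuyHilado2025, §3.9] -/
theorem residueChar_mem_supportPrimes_of_bad (T : Cor22.ThetaVolumeDatumAt P l) :
    (letI := T.instFieldF; letI := T.instNumberFieldF; letI := T.instAlgebraF; letI := T.instFieldK
     letI := T.instNumberFieldK; letI := T.instAlgebraK; letI := T.instFieldFbar; letI := T.instAlgebraFbar
     letI := T.instAlgebraKFbar; letI := T.instIsElliptic
     ∀ v : HeightOneSpectrum (𝓞 (fieldOfModuli T.E)), v ∈ ThetaData.badPrimesMod T.D →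
       residueChar (fieldOfModuli T.E) v ∈ T.I.supportPrimes) := by
  letI := T.instFieldF; letI := T.instNumberFieldF; letI := T.instAlgebraF; letI := T.instFieldK
  letI := T.instNumberFieldK; letI := T.instAlgebraK; letI := T.instFieldFbar; letI := T.instAlgebraFbar
  letI := T.instAlgebraKFbar; letI := T.instIsElliptic
  intro v hv
  have hv' : v ∈ T.I.X.S := by rw [(X_S_eq T).1]; exact hv
  exact T.I.residueChar_mem_supportPrimes hv'

/-- **The (U)-computable half at a datum bounds the local height of `j(λ)` at every split bad place.** If
`T.HullEstimateOf δ`, then for every bad place `v ∈ 𝕍^bad_mod` of `F_mod` and every place `w ∉ 𝕍^bad_mod` of `F_mod`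
over the SAME rational prime `p` (a place of good reduction, or one dividing `2l`):
`Pr(v)·Pr(w)·(l(l+1)/12)·((−ord_v(j_E))/(2l))·ln N(v)/n_v ≤ δ`, i.e.
`Pr(v)·Pr(w)·((l+1)/24)·(−ord_v(j_E))·ln N(v)/n_v ≤ δ` — the `Pr`-weighted local height of the `q`-parameter at ONE
place is dominated by the hull constant. [cite: Mochizuki2012, IUTchIV Thm. 1.10 Step (v) p. 27–28]
[cite: DupuyHilado2025, §3.3, §3.6, §4.7, §4.12] [claim: Mochizuki2012, status: disputed] -/
theorem ordPair_le_of_hullEstimateOf (T : Cor22.ThetaVolumeDatumAt P l) {δ : ℝ} (h : T.HullEstimateOf δ) :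
    (letI := T.instFieldF; letI := T.instNumberFieldF; letI := T.instAlgebraF; letI := T.instFieldK
     letI := T.instNumberFieldK; letI := T.instAlgebraK; letI := T.instFieldFbar; letI := T.instAlgebraFbar
     letI := T.instAlgebraKFbar; letI := T.instIsElliptic
     ∀ (p : ℕ) [Fact p.Prime] (v w : placesOver (fieldOfModuli T.E) p),
       v.1 ∈ ThetaData.badPrimesMod T.D → w.1 ∉ ThetaData.badPrimesMod T.D →
       weight (fieldOfModuli T.E) v.1 * weight (fieldOfModuli T.E) w.1 * ((l : ℝ) * ((l : ℝ) + 1) / 12) *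
         (((-ord (fieldOfModuli T.E) v.1 (ThetaData.jMod T.E) : ℤ) : ℝ) / (2 * (l : ℝ)) *
           logNorm (fieldOfModuli T.E) v.1 / (localDegree (fieldOfModuli T.E) v.1 : ℝ)) ≤ δ) := by
  letI := T.instFieldF; letI := T.instNumberFieldF; letI := T.instAlgebraF; letI := T.instFieldK
  letI := T.instNumberFieldK; letI := T.instAlgebraK; letI := T.instFieldFbar; letI := T.instAlgebraFbar
  letI := T.instAlgebraKFbar; letI := T.instIsElliptic
  intro p _ v w hv hw
  have hp : p ∈ T.I.supportPrimes := by
    have h1 := residueChar_mem_supportPrimes_of_bad T v.1 hv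
    rwa [(mem_placesOver_iff_residueChar v.1).mp v.2] at h1
  have hpair := pair_le_of_hullEstimateOf T h p hp v w
  have hμv := mu_eq T v.1
  have hμw := mu_eq T w.1
  rw [if_pos hv] at hμv
  rw [if_neg hw] at hμw
  rw [hμv, hμw, sub_zero] at hpair
  exact hpair

/-- **The (U)-line's child (ii′) AT THE `λ`-LINE, place by place.** `Cor22.HullVolumeAtDatum P l δ` (the conclusion
of the crux's registered stubs `stub_hullVolume` / `stub_hullRegime` of stmt-ABC-19678, there with print's
`δ = B_III(P,l)`) asserts, for EVERY genuine Θ-volume datum `T` at `(P, l)`, every bad place `v ∈ 𝕍^bad_mod` of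
`F_mod = ℚ(j_E)` and every place `w ∉ 𝕍^bad_mod` of `F_mod` over the same rational prime:
`Pr(v)·Pr(w)·(l(l+1)/12)·((−ord_v(j_E))/(2l))·ln N(v)/n_v ≤ δ`. Empty at `d_mod = 1` (one place over each prime);
at `d_mod ≥ 2` a Diophantine statement about the point that no volume computation supplies
(`LDHSlotResidueSplitWitness.exists_deepSplitAt_not_hullEstimateOf`). Nothing asserted about any point; no side taken.
[cite: Mochizuki2012, IUTchIV Thm. 1.10 Step (v) p. 27–28] [cite: Mochizuki2012, IUTchIV Cor. 2.2 (ii) proof p. 46]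
[claim: Mochizuki2012, status: disputed] -/
theorem ordPair_le_of_hullVolumeAtDatum {δ : ℝ} (h : Cor22.HullVolumeAtDatum P l δ) (T : Cor22.ThetaVolumeDatumAt P l) :
    (letI := T.instFieldF; letI := T.instNumberFieldF; letI := T.instAlgebraF; letI := T.instFieldK
     letI := T.instNumberFieldK; letI := T.instAlgebraK; letI := T.instFieldFbar; letI := T.instAlgebraFbar
     letI := T.instAlgebraKFbar; letI := T.instIsElliptic
     ∀ (p : ℕ) [Fact p.Prime] (v w : placesOver (fieldOfModuli T.E) p),
       v.1 ∈ ThetaData.badPrimesMod T.D → w.1 ∉ ThetaData.badPrimesMod T.D →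
       weight (fieldOfModuli T.E) v.1 * weight (fieldOfModuli T.E) w.1 * ((l : ℝ) * ((l : ℝ) + 1) / 12) *
         (((-ord (fieldOfModuli T.E) v.1 (ThetaData.jMod T.E) : ℤ) : ℝ) / (2 * (l : ℝ)) *
           logNorm (fieldOfModuli T.E) v.1 / (localDegree (fieldOfModuli T.E) v.1 : ℝ)) ≤ δ) :=
  ordPair_le_of_hullEstimateOf T (h T)

/-- **The two bad places form**: if BOTH `v, w ∈ 𝕍^bad_mod` lie over the same prime, `T.HullEstimateOf δ` bounds the
weighted DIFFERENCE of their normalised local heights: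
`Pr(v)·Pr(w)·(l(l+1)/12)·((−ord_v(j_E))·ln N(v)/(2l·n_v) − (−ord_w(j_E))·ln N(w)/(2l·n_w)) ≤ δ` (and symmetrically
with `v, w` exchanged, so the absolute difference is bounded). [cite: Mochizuki2012, IUTchIV Thm. 1.10 Step (v) p. 27–28]
[cite: DupuyHilado2025, §3.3, §3.6, §4.7, §4.12] [claim: Mochizuki2012, status: disputed] -/
theorem ordPairBad_le_of_hullEstimateOf (T : Cor22.ThetaVolumeDatumAt P l) {δ : ℝ} (h : T.HullEstimateOf δ) :
    (letI := T.instFieldF; letI := T.instNumberFieldF; letI := T.instAlgebraF; letI := T.instFieldK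
     letI := T.instNumberFieldK; letI := T.instAlgebraK; letI := T.instFieldFbar; letI := T.instAlgebraFbar
     letI := T.instAlgebraKFbar; letI := T.instIsElliptic
     ∀ (p : ℕ) [Fact p.Prime] (v w : placesOver (fieldOfModuli T.E) p),
       v.1 ∈ ThetaData.badPrimesMod T.D → w.1 ∈ ThetaData.badPrimesMod T.D →
       weight (fieldOfModuli T.E) v.1 * weight (fieldOfModuli T.E) w.1 * ((l : ℝ) * ((l : ℝ) + 1) / 12) *
         (((-ord (fieldOfModuli T.E) v.1 (ThetaData.jMod T.E) : ℤ) : ℝ) / (2 * (l : ℝ)) *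
             logNorm (fieldOfModuli T.E) v.1 / (localDegree (fieldOfModuli T.E) v.1 : ℝ)
           - ((-ord (fieldOfModuli T.E) w.1 (ThetaData.jMod T.E) : ℤ) : ℝ) / (2 * (l : ℝ)) *
             logNorm (fieldOfModuli T.E) w.1 / (localDegree (fieldOfModuli T.E) w.1 : ℝ)) ≤ δ) := by
  letI := T.instFieldF; letI := T.instNumberFieldF; letI := T.instAlgebraF; letI := T.instFieldK
  letI := T.instNumberFieldK; letI := T.instAlgebraK; letI := T.instFieldFbar; letI := T.instAlgebraFbar
  letI := T.instAlgebraKFbar; letI := T.instIsElliptic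
  intro p _ v w hv hw
  have hp : p ∈ T.I.supportPrimes := by
    have h1 := residueChar_mem_supportPrimes_of_bad T v.1 hv
    rwa [(mem_placesOver_iff_residueChar v.1).mp v.2] at h1
  have hpair := pair_le_of_hullEstimateOf T h p hp v w
  have hμv := mu_eq T v.1
  have hμw := mu_eq T w.1
  rw [if_pos hv] at hμv
  rw [if_pos hw] at hμw
  rw [hμv, hμw] at hpair
  exact hpair

end PointDict

end Summit.ABC.IUTFork

end
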